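import Mathlib
import Summits.Ventures.PercRepro2.Defs
import Summits.Ventures.PercRepro2.Graph
import Summits.Ventures.PercRepro2.Induced
import Summits.Ventures.PercRepro2.VdBKahn
import Summits.Ventures.PercRepro2.ReimerVdBK
import Summits.Ventures.PercRepro2.ReimerVdBKRegions
import Summits.Ventures.PercRepro2.ReimerVdBKZClosed
import Summits.Ventures.PercRepro2.ReimerVdBKZReduction
import Summits.Ventures.PercRepro2.ReimerVdBKZSplit
import Summits.Ventures.PercRepro2.ReimerVdBKZRecursion
import Summits.Ventures.PercRepro2.ReimerVdBKTypeWeight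
import Summits.Ventures.PercRepro2.ReimerVdBKPairType
import Summits.Ventures.PercRepro2.ReimerVdBKCoreDown
import Summits.Ventures.PercRepro2.ReimerVdBKCoreD
import Summits.Ventures.PercRepro2.ReimerVdBKDegTwoGraph
import Summits.Ventures.PercRepro2.ReimerVdBKDegTwoFlip
import Summits.Ventures.PercRepro2.ReimerVdBKDegTwoExpansion
import Summits.Ventures.PercRepro2.ReimerVdBKDegTwoCalc

/-!
# (OUTER): (CORE↓) at `N` fibre-wise over the outer stars of a revealed set `R`, modulo independent flips
(blind cell PercRepro2, mine-c g48; `conjectures/MINE-C.md` §57.4–57.5)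

For a vertex set `R` the OUTER STAR of `v ∈ R` is the set of edges from `v` to a vertex outside `R`
(`outerStar`).  For a colouring `c` the OUTER FIBRE of `c` at `R` (`outerFibre`) is the set of colourings
`ω` that agree with `c` on every outer star up to the flip of that whole star — `ω ⊕ c` is constant on each
outer star (`shiftTied`) —: the edges inside `R` and the edges among the other vertices are free.  The
statement **(OUTER-R)** (`OuterDown … N R`): for every `c`, the core-restricted (at `N`) two-world count
of the Harris pair on the outer fibre of `c` is at most that of its right-hand instance.  `R = ∅`: (CORE↓)
at `N`; `N = R = ∅`: Harris (`outerDown_of_empty`); `N = R = {v}`: the fibres are the pattern classes of the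
star of `v` — g47's (VCLASS) at `v` (`MINE-C.md` §56.8); `R = N`: (OUTER-N) of §57.4; `R = coreFree X Y N
= N ∪ X ∪ Y` (the vertices whose weight vanishes when they lie in both clusters): the statement of record
(OUTER-𝓡) of §57.5.  THEOREM `coreDown_of_outerDown`: (OUTER-R) implies (CORE↓) at `N` for every `R` —
summing the fibre inequalities over all `c` counts every colouring exactly `count (outerTied R)` times (the
map `c ↦ ω ⊕ c` is an involution) — hence the chain (OUTER-𝓡) ⟹ (CORE↓)_N ⟹ (R-1.2) (`rvdBK_of_coreDown`).
Census (`MINE-C.md` §57.4–57.5, own code + an independent python twin): 0 violations of (OUTER-N) on every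
graph with ≤ 5 vertices (every Harris instance, every `N`) and on every labelled 6-vertex graph (instances
with ≥ 2 `N`-vertices and a nonempty left side, kit j336348: 115,159,562 instances), where the finer elimination pairing (one coin per
component of `G[N]`) is already false (§57.3); 0 violations of (OUTER-𝓡) on every graph with ≤ 5 vertices,
every Harris instance (2,979,378 with a nonempty left side at n = 5); revealing the star of a vertex whose
weight does not vanish on the core (types U, A, B, A∩B) fails from n = 5 on (§57.5).
-/

namespace Summit.Ventures.PercRepro2
namespace ReimerVdBK
open Classical

variable {V : Type*} {E : Type*} [Fintype E] [DecidableEq E] [Fintype V] [DecidableEq V]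
variable (ends : E → Sym2 V) (s : V)

/-! ## Outer stars, shifted tied sets, outer fibres -/

/-- The outer star of `v` relative to `R`: the edges joining `v` to a vertex outside `R`. -/
def outerStar (R : Finset V) (v : V) : Finset E :=
  Finset.univ.filter fun e => ∃ w, ends e = s(v, w) ∧ w ∉ R

/-- The pointwise exclusive or of two colourings. -/
def xorC (ω c : Config E) : Config E := fun e => xor (ω e) (c e)

omit [Fintype E] [DecidableEq E] in
/-- `xorC ω` is an involution. -/
lemma xorC_involutive (ω : Config E) : Function.Involutive (xorC ω) := by
  intro c
  funext e
  simp only [xorC]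
  cases ω e <;> cases c e <;> rfl

/-- Reindexing a sum over the colourings by `xorC ω`. -/
lemma sum_xorC (ω : Config E) (g : Config E → ℕ) : ∑ c : Config E, g (xorC ω c) = ∑ c : Config E, g c :=
  Equiv.sum_comp (Function.Involutive.toPerm _ (xorC_involutive ω)) g

/-- The colourings constant on `F` after the shift by `c`: the fibre of the pattern `c|F` modulo the flip of `F`. -/
def shiftTied (c : Config E) (F : Finset E) : Set (Config E) :=
  {ω | ∀ e ∈ F, ∀ e' ∈ F, xor (ω e) (c e) = xor (ω e') (c e')}

/-- The colourings constant on every outer star of `R`. -/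
def outerTied (R : Finset V) : Set (Config E) :=
  {d | ∀ v ∈ R, ∀ e ∈ outerStar ends R v, ∀ e' ∈ outerStar ends R v, d e = d e'}

/-- The outer fibre of `c` at `R`: constant after the shift by `c` on every outer star of `R`. -/
def outerFibre (c : Config E) (R : Finset V) : Set (Config E) :=
  {ω | ∀ v ∈ R, ω ∈ shiftTied c (outerStar ends R v)}

omit [DecidableEq E] in
/-- Membership in the outer fibre is membership of the shifted colouring in the outer tied set. -/
lemma mem_outerFibre_iff {c : Config E} {R : Finset V} {ω : Config E} :
    ω ∈ outerFibre ends c R ↔ xorC ω c ∈ outerTied ends R := Iff.rfl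

omit [DecidableEq E] in
/-- The constant colouring `false` is constant on every outer star. -/
lemma const_false_mem_outerTied (R : Finset V) : (fun _ => false : Config E) ∈ outerTied ends R :=
  fun _ _ _ _ _ _ => rfl

/-- The outer tied set has a positive count. -/
lemma count_outerTied_pos (R : Finset V) : 0 < count (outerTied ends R) := by
  unfold count
  refine Finset.sum_pos' (fun ω _ => by split_ifs <;> omega) ⟨(fun _ => false), Finset.mem_univ _, ?_⟩
  rw [if_pos (const_false_mem_outerTied ends R)]
  exact Nat.one_pos

/-- Every colouring lies in exactly `count (outerTied R)` outer fibres. -/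
lemma sum_mem_outerFibre (R : Finset V) (ω : Config E) :
    ∑ c : Config E, (if ω ∈ outerFibre ends c R then (1 : ℕ) else 0) = count (outerTied ends R) := by
  unfold count
  rw [← sum_xorC ω (fun d => if d ∈ outerTied ends R then (1 : ℕ) else 0)]
  rfl

/-! ## The statement and the implication -/

section Statement
variable (A X B Y N R : Finset V)

/-- The core-free vertices of the instance: the unmarked core-avoided set `N` and the avoided sets `X`, `Y`
(`A ∩ Y` and `B ∩ X` included) — exactly the types whose weight vanishes on a vertex of both clusters. -/
def coreFree : Finset V := N ∪ X ∪ Y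

/-- The core-restricted (at `N`) two-world count on the outer fibre of `c` at `R`. -/
noncomputable def outerCount (c : Config E) : ℕ :=
  ∑ ω : Config E, if ω ∈ twoWorld ends s A X B Y ∧ CoreAvoid ends s N ω ∧ ω ∈ outerFibre ends c R then 1 else 0

/-- **(OUTER-R)** for the Harris pair `(A, X; B, Y)`, the unmarked core-avoided set `N` and the revealed set
`R`: on every outer fibre of `R` the core-restricted left count is at most the core-restricted right count.
(Meant for `R = N` — (OUTER-N) — and for `R = coreFree X Y N` — (OUTER-𝓡), the statement of record.) -/
def OuterDown : Prop :=
  ∀ c : Config E, outerCount ends s A X B Y N R c ≤ outerCount ends s (A ∪ B) ∅ ∅ (X ∪ Y) N R c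

/-- Summing the outer counts over all patterns `c` counts the core-restricted count `count (outerTied R)` times. -/
lemma sum_outerCount :
    ∑ c : Config E, outerCount ends s A X B Y N R c = count (outerTied ends R) * coreCount ends s A X B Y N := by
  unfold outerCount
  rw [Finset.sum_comm, coreCount_eq_sum_coreAvoid, Finset.mul_sum]
  refine Finset.sum_congr rfl fun ω _ => ?_
  by_cases h : ω ∈ twoWorld ends s A X B Y ∧ CoreAvoid ends s N ω
  · rw [if_pos h, mul_one, ← sum_mem_outerFibre ends R ω]
    refine Finset.sum_congr rfl fun c _ => ?_
    by_cases hc : ω ∈ outerFibre ends c R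
    · rw [if_pos hc, if_pos ⟨h.1, h.2, hc⟩]
    · rw [if_neg hc, if_neg (fun h' => hc h'.2.2)]
  · rw [if_neg h, mul_zero]
    exact Finset.sum_eq_zero fun c _ => if_neg (fun h' => h ⟨h'.1, h'.2.1⟩)

/-- **(OUTER-R) implies (CORE↓) at `N`**, for every revealed set `R`. -/
theorem coreDown_of_outerDown (h : OuterDown ends s A X B Y N R) : CoreDown ends s A X B Y N := by
  unfold CoreDown
  have hsum : ∑ c : Config E, outerCount ends s A X B Y N R c ≤
      ∑ c : Config E, outerCount ends s (A ∪ B) ∅ ∅ (X ∪ Y) N R c :=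
    Finset.sum_le_sum fun c _ => h c
  rw [sum_outerCount, sum_outerCount] at hsum
  exact Nat.le_of_mul_le_mul_left hsum (count_outerTied_pos ends R)

/-- **(OUTER-𝓡) implies (CORE↓) at `N`**: the statement of record of `MINE-C.md` §57.5 implies the kernel's
hypothesis, hence (R-1.2) through `rvdBK_of_coreDown`. -/
theorem coreDown_of_outerDown_coreFree (h : OuterDown ends s A X B Y N (coreFree X Y N)) :
    CoreDown ends s A X B Y N :=
  coreDown_of_outerDown ends s A X B Y N (coreFree X Y N) h

omit [DecidableEq E] in
/-- With `R = ∅` every outer fibre is the whole space. -/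
lemma outerFibre_empty (c : Config E) : outerFibre ends c (∅ : Finset V) = Set.univ := by
  ext ω
  simp only [outerFibre, Set.mem_setOf_eq, Finset.notMem_empty, IsEmpty.forall_iff, implies_true,
    Set.mem_univ]

/-- With `R = ∅` the outer count is the core-restricted count at `N`. -/
lemma outerCount_empty_R (c : Config E) :
    outerCount ends s A X B Y N ∅ c = coreCount ends s A X B Y N := by
  unfold outerCount
  rw [coreCount_eq_sum_coreAvoid]
  refine Finset.sum_congr rfl fun ω _ => ?_
  have hf : ω ∈ outerFibre ends c (∅ : Finset V) := by rw [outerFibre_empty]; exact Set.mem_univ ω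
  simp only [hf, and_true]

/-- With `R = ∅`, (OUTER-R) is (CORE↓) at `N`. -/
lemma outerDown_empty_R_iff : OuterDown ends s A X B Y N ∅ ↔ CoreDown ends s A X B Y N := by
  unfold OuterDown CoreDown
  simp only [outerCount_empty_R]
  exact ⟨fun h => h (fun _ => false), fun h _ => h⟩

/-- With `N = R = ∅` the outer count is the two-world count. -/
lemma outerCount_empty (c : Config E) :
    outerCount ends s A X B Y ∅ ∅ c = reimerCount ends s A X B Y := by
  unfold outerCount reimerCount count
  refine Finset.sum_congr rfl fun ω _ => ?_
  have hca : CoreAvoid ends s (∅ : Finset V) ω := fun w hw => absurd hw (Finset.notMem_empty w)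
  have hf : ω ∈ outerFibre ends c (∅ : Finset V) := by rw [outerFibre_empty]; exact Set.mem_univ ω
  simp only [hca, hf, and_true]

/-- With `N = R = ∅`, (OUTER) is (R-1.2) on the Harris pair — Harris (`rvdBK_of_disjoint`). -/
theorem outerDown_of_empty (hXY : X ∩ Y = ∅) : OuterDown ends s A X B Y ∅ ∅ := by
  intro c
  rw [outerCount_empty, outerCount_empty]
  have h := rvdBK_of_disjoint ends s A X B Y hXY
  unfold RvdBK at h
  rwa [hXY] at h

end Statement

end ReimerVdBK
end Summit.Ventures.PercRepro2
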